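import Mathlib
import Summits.QuantumFields.YangMills.Theses.AspectPurityFloor
import HarnessLib

/-!
# Route `AspectPurityFloor` (planner ym-idea-4 g19, LINE g19-A), item ⟨stmt-QuantumFields-23746⟩ `Assembly` — CLOSED

`assembly_proof : Summit.QuantumFields.YangMills.Theses.AspectPurityFloor.Assembly`, i.e.
`WindowPurityFloor → TailPurityFloor → SmallToriEntropy → ParticipationDoor → ThermalTraceWindow.FewBodyEntropy`.
Real-inequality bookkeeping only: split `L ≤ L₀'` (small tori: `SmallToriEntropy`) / `L₀' ≤ L ≤ β^a` (window purity floor) /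
`β^a ≤ L` (tail purity floor), feed the participation ratio `P = Z(⌊L/2⌋)²/Z(2⌊L/2⌋)` bound into `ParticipationDoor`, and merge the
constants (`C = C₁ + C₂ + C₃`, `q = max`, `p = max`, with `β ≥ 1`, `L ≥ 1` for exponent monotonicity).
HONEST FRAMING: the cruxes `WindowPurityFloor` / `TailPurityFloor` and the support `SmallToriEntropy` are OPEN; K1a, R2ξ″ and the YM mass
gap are NOT proved.  No `sorry`, no new axiom, no new definition.  References: [cite: Luscher1983, §2]; [cite: MontvayMunster1994, (3.145)].
-/

set_option autoImplicit false

noncomputable section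

namespace Summit.QuantumFields.YangMills.Theorems.AspectPurityFloor

open Summit.QuantumFields.YangMills.Theorems.FemtoTransferGap

/-- The participation ratio bound: from `A² ≤ K·B` with `K ≥ 0`, `A²/B ≤ K` (all sign cases, with Lean's `x/0 = 0`). [folklore] -/
theorem sq_div_le_of_sq_le {A B K : ℝ} (hK : 0 ≤ K) (h : A ^ 2 ≤ K * B) : A ^ 2 / B ≤ K := by
  rcases lt_trichotomy B 0 with hB | hB | hB
  · have hA : A ^ 2 = 0 := le_antisymm (h.trans (by nlinarith)) (sq_nonneg A)
    rw [hA, zero_div]; exact hK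
  · rw [hB, div_zero]; exact hK
  · rw [div_le_iff₀ hB]; exact h

/-- ★★★ **`AspectPurityFloor.Assembly`** ⟨stmt-QuantumFields-23746⟩. [cite: Luscher1983, §2] [cite: MontvayMunster1994, (3.145)] -/
theorem assembly_proof : Summit.QuantumFields.YangMills.Theses.AspectPurityFloor.Assembly := by
  intro hW hT hS hP
  obtain ⟨a, ha, C₁, q₁, p₁, β₁, hC₁, L₀, hWin⟩ := hW
  obtain ⟨C₂, q₂, p₂, β₂, hC₂, hTail⟩ := hT a ha
  obtain ⟨C₃, q₃, β₃, hC₃, hSmall⟩ := hS (max L₀ 4)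
  refine ⟨C₁ + C₂ + C₃, max (max q₁ q₂) (max q₃ 0), max (max p₁ p₂) 0, by linarith,
    max (max β₁ β₂) (max β₃ 1), fun β hβ L _ hL2 => ?_⟩
  have hβ₁ : β₁ ≤ β := le_trans (le_trans (le_max_left _ _) (le_max_left _ _)) hβ
  have hβ₂ : β₂ ≤ β := le_trans (le_trans (le_max_right _ _) (le_max_left _ _)) hβ
  have hβ₃ : β₃ ≤ β := le_trans (le_trans (le_max_left _ _) (le_max_right _ _)) hβ
  have hβ1 : (1 : ℝ) ≤ β := le_trans (le_trans (le_max_right _ _) (le_max_right _ _)) hβ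
  have hL1 : (1 : ℝ) ≤ (L : ℝ) := by exact_mod_cast (le_trans (by norm_num) hL2)
  set q : ℝ := max (max q₁ q₂) (max q₃ 0) with hq
  set p : ℝ := max (max p₁ p₂) 0 with hp
  set r : ℝ := Real.sqrt ((levelValue su2Rep L β 1 / levelValue su2Rep L β 0) ^ L) with hr
  have hr0 : 0 ≤ r := Real.sqrt_nonneg _
  have hlam : 0 ≤ levelValue su2Rep L β 0 ^ L := pow_nonneg (levelValue_zero_su2Rep_pos L β).le _
  -- exponent monotonicity
  have hβq : ∀ q' : ℝ, q' ≤ q → β ^ q' ≤ β ^ q := fun q' hq' => Real.rpow_le_rpow_of_exponent_le hβ1 hq'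
  have hLp : ∀ p' : ℝ, p' ≤ p → (L : ℝ) ^ p' ≤ (L : ℝ) ^ p := fun p' hp' => Real.rpow_le_rpow_of_exponent_le hL1 hp'
  have hβq0 : 0 ≤ β ^ q := Real.rpow_nonneg (by linarith) _
  have hLp0 : 0 ≤ (L : ℝ) ^ p := Real.rpow_nonneg (by linarith) _
  have hLp1 : 1 ≤ (L : ℝ) ^ p := Real.one_le_rpow hL1 (le_max_right _ _)
  -- the common final step: from `Z ≤ (1 + K r) λ₀^L` with `K ≤ C β^q L^p`
  have finish : ∀ K : ℝ, K ≤ (C₁ + C₂ + C₃) * β ^ q * (L : ℝ) ^ p →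
      TT.physTrace L β L ≤ (1 + K * r) * levelValue su2Rep L β 0 ^ L →
      TT.physTrace L β L ≤ (1 + (C₁ + C₂ + C₃) * β ^ q * (L : ℝ) ^ p * r) * levelValue su2Rep L β 0 ^ L := by
    intro K hK hZ
    refine hZ.trans (mul_le_mul_of_nonneg_right ?_ hlam)
    have := mul_le_mul_of_nonneg_right hK hr0
    linarith
  by_cases hsmall : L ≤ max L₀ 4
  · -- small tori
    have hZ := hSmall β hβ₃ L hL2 hsmall
    refine finish (C₃ * β ^ q₃) ?_ (by simpa only [mul_assoc] using hZ)
    have h1 : C₃ * β ^ q₃ ≤ C₃ * β ^ q := mul_le_mul_of_nonneg_left (hβq q₃ (le_trans (le_max_left _ _) (le_max_right _ _))) hC₃.le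
    have h2 : C₃ * β ^ q ≤ C₃ * β ^ q * (L : ℝ) ^ p := le_mul_of_one_le_right (mul_nonneg hC₃.le hβq0) hLp1
    have h3 : C₃ * β ^ q * (L : ℝ) ^ p ≤ (C₁ + C₂ + C₃) * β ^ q * (L : ℝ) ^ p :=
      mul_le_mul_of_nonneg_right (mul_le_mul_of_nonneg_right (by linarith) hβq0) hLp0
    linarith
  · -- large tori: participation door + a purity floor
    have hL4 : 4 ≤ L := le_trans (le_max_right _ _) (not_le.mp hsmall).le
    have hL₀ : L₀ ≤ L := le_trans (le_max_left _ _) (not_le.mp hsmall).le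
    have hZ := hP L β hβ1 hL4
    set P : ℝ := TT.physTrace L β (L / 2) ^ 2 / TT.physTrace L β (2 * (L / 2)) with hPdef
    refine finish P ?_ hZ
    by_cases hwin : (L : ℝ) ≤ β ^ a
    · have h := hWin β hβ₁ L hL₀ hwin
      have hK0 : 0 ≤ C₁ * β ^ q₁ * (L : ℝ) ^ p₁ :=
        mul_nonneg (mul_nonneg hC₁.le (Real.rpow_nonneg (by linarith) _)) (Real.rpow_nonneg (by linarith) _)
      have hPle : P ≤ C₁ * β ^ q₁ * (L : ℝ) ^ p₁ := sq_div_le_of_sq_le hK0 h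
      have h1 : C₁ * β ^ q₁ * (L : ℝ) ^ p₁ ≤ C₁ * β ^ q * (L : ℝ) ^ p :=
        mul_le_mul (mul_le_mul_of_nonneg_left (hβq q₁ (le_trans (le_max_left _ _) (le_max_left _ _))) hC₁.le)
          (hLp p₁ (le_trans (le_max_left _ _) (le_max_left _ _))) (Real.rpow_nonneg (by linarith) _) (mul_nonneg hC₁.le hβq0)
      have h3 : C₁ * β ^ q * (L : ℝ) ^ p ≤ (C₁ + C₂ + C₃) * β ^ q * (L : ℝ) ^ p :=
        mul_le_mul_of_nonneg_right (mul_le_mul_of_nonneg_right (by linarith) hβq0) hLp0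
      linarith
    · have hge : β ^ a ≤ (L : ℝ) := (not_le.mp hwin).le
      have h := hTail β hβ₂ L hL4 hge
      have hK0 : 0 ≤ C₂ * β ^ q₂ * (L : ℝ) ^ p₂ :=
        mul_nonneg (mul_nonneg hC₂.le (Real.rpow_nonneg (by linarith) _)) (Real.rpow_nonneg (by linarith) _)
      have hPle : P ≤ C₂ * β ^ q₂ * (L : ℝ) ^ p₂ := sq_div_le_of_sq_le hK0 h
      have h1 : C₂ * β ^ q₂ * (L : ℝ) ^ p₂ ≤ C₂ * β ^ q * (L : ℝ) ^ p :=
        mul_le_mul (mul_le_mul_of_nonneg_left (hβq q₂ (le_trans (le_max_right _ _) (le_max_left _ _))) hC₂.le)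
          (hLp p₂ (le_trans (le_max_right _ _) (le_max_left _ _))) (Real.rpow_nonneg (by linarith) _) (mul_nonneg hC₂.le hβq0)
      have h3 : C₂ * β ^ q * (L : ℝ) ^ p ≤ (C₁ + C₂ + C₃) * β ^ q * (L : ℝ) ^ p :=
        mul_le_mul_of_nonneg_right (mul_le_mul_of_nonneg_right (by linarith) hβq0) hLp0
      linarith

end Summit.QuantumFields.YangMills.Theorems.AspectPurityFloor

end
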